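import Literature.NumberTheory.GaloisRepresentations.ContinuousH2
import HarnessLib

/-!
# The cochain form of the connecting map `H¹(G, M/Z) → H²(G, Z)` and the cup product of a cocycle that
# becomes a coboundary in a bigger module (Kato, LNM 1553, Ch. II, Lemma 1.4.3 — the "formal argument")

Topic `Literature/NumberTheory/GaloisRepresentations`; namespace `Literature.NumberTheory.GaloisRepresentations`.
One definition (a `Prop`-valued predicate) and theorems; no named fact, no instance, no `sorry`.

Setting: a topological group `G`, topological representations over a commutative ring `R` (Mathlib `TopRep`), and the
tree's continuous inhomogeneous cocycles (`contOneCocycles`, `contTwoCocycles`, `twoCocycleClass`, `ContPairing.cupCocycle`,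
`ContinuousH1/H2`). For a morphism `ι : Z ⟶ M` ("`Z ⊆ M`") we say that a continuous `1`-cochain `h : G → M`
**integrates** a continuous `2`-cocycle `c` of `Z` when `∂h = ι ∘ c`:

  `ι(c(σ, τ)) = σ h(τ) − h(στ) + h(σ)`   (`Integrates ι h c`).

This is the COCHAIN presentation of the connecting homomorphism `δ : H¹(G, M/Z) → H²(G, Z)`, `[h mod Z] ↦ [c]`, usable when
the quotient `M/Z` is not a convenient topological module (e.g. `M = B_dR⁺(1)`, `Z = ℚ_p(1)`): no quotient is formed. We prove

* §1 bookkeeping: `Integrates` is additive and `R`-linear in `(h, c)`; a `Z`-valued change of `h` changes `c` by a coboundary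
  and an `M`-cocycle change of `h` does not change `c`, so **the class `[c] ∈ H²(G, Z)` depends only on `h` modulo `ι(C¹(G,Z))`
  and `Z¹(G, M)`** (`twoCocycleClass_eq_of_integrates`, injective `ι`) — well-definedness of `δ` on `H¹(G, M/Z)`;
* §2 ★ **Kato's formal argument** (`integrates_cupCocycle_of_eq_sub`): for pairings `φ : X × Y → Z`, `Φ : M_X × Y → M_Z`
  compatible along `i_X : X ⟶ M_X`, `ι : Z ⟶ M_Z`, a `1`-cocycle `f` of `X` that becomes a COBOUNDARY in `M_X`
  (`i_X(f σ) = σ x − x`) and any `1`-cocycle `g` of `Y`, the cup product `f ∪ g` (`(σ,τ) ↦ ⟨f σ, σ g τ⟩`) is integrated by the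
  explicit cochain **`h(τ) = Φ(x, g τ)`**: `[f ∪ g] = δ[τ ↦ Φ(x, g τ) mod Z]`. (Kato II 1.4.3: `exp(a) ∪ b` is the image under the
  connecting map of an explicit class, "by a formal argument on cohomology"; here with `exp` replaced by ANY integrating element
  `x`, e.g. the tree's `B_dR⁺`-integrals of Kummer cocycles `AinfWeierstrassKummerIntegral`, `BdRKummerUnitPeriod`.)
* §3 **calibration cochains** (`integrates_smul_of_sub_eq`): if `ℓ ∈ M` integrates a `1`-cocycle `κ` of `Z` (`ι(κ σ) = σ ℓ − ℓ`,
  e.g. `ℓ = ℓ_u`, `κ` = Kummer cocycle of `u` times `t`) and `ψ : G → R` is a continuous additive character, then `h(τ) = ψ(τ)•ℓ`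
  integrates the cup product `(σ, τ) ↦ ψ(τ) • κ(σ)` (`smulCupCocycle κ ψ`) — Kato II §1.4.4 `δ(a·log χ) = exp(a) ∪ log χ` in
  cochain form.

Use: floors (H1)–(H2) of the B₂ road to Kato's explicit reciprocity law for `V_pE` (crux K★ `stmt-BirchSwinnertonDyer-22226`,
`Cruxes/StarredOptimalManinUnitFiveSeven/Lines/kato-lever-K3-B2-road.md`). Pure cochain algebra; nothing about BSD is proved here.

## References
* K. Kato, *Lectures on the approach to Iwasawa theory for Hasse–Weil L-functions via B_dR, Part I*, LNM 1553 (1993),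
  Ch. II Lemma 1.4.3, §1.4.4. [Kato1993LNM1553]
* J. Neukirch, A. Schmidt, K. Wingberg, *Cohomology of Number Fields*, 2nd ed. (2008), I §3 (1.3.2) (connecting
  homomorphism on cochains), I §4 (1.4.1)–(1.4.3) (cup products and `∂`). [NeukirchSchmidtWingberg2008]
* J.-P. Serre, *Galois Cohomology* (1997), I §2.2–2.3. [SerreGaloisCohomology1997]
-/

noncomputable section

open CategoryTheory

universe u v

namespace Literature.NumberTheory.GaloisRepresentations

open TopRep ContRepresentation ContinuousCohomology

variable {R : Type u} [CommRing R] [TopologicalSpace R]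
variable {G : Type v} [Group G] [TopologicalSpace G] [IsTopologicalGroup G] [LocallyCompactSpace G]

/-! ## §1 Integrating cochains and the well-definedness of the connecting class -/

section Integrates

variable {Z M : TopRep.{v} R G} (ι : Z ⟶ M)

/-- **`h` integrates `c` along `ι : Z → M`**: the continuous `1`-cochain `h : G → M` has inhomogeneous coboundary
`∂h(σ,τ) = σ h(τ) − h(στ) + h(σ)` equal to `ι ∘ c` for the continuous `2`-cocycle `c` of `Z`. Then `h mod Z` is a `1`-cocycle of
`M/Z` and `[c] = δ[h mod Z]` (NSW (1.3.2)); this predicate is the quotient-free form of that statement.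
[cite: NeukirchSchmidtWingberg2008, I §3 (1.3.2)] [cite: SerreGaloisCohomology1997, I §2.2] -/
def Integrates (h : C(G, M)) (c : contTwoCocycles Z) : Prop :=
  ∀ σ τ : G, ι.hom (c.1 (σ, τ)) = M.ρ σ (h τ) - h (σ * τ) + h σ

omit [IsTopologicalGroup G] [LocallyCompactSpace G] in
/-- Unfolding `Integrates`. [cite: NeukirchSchmidtWingberg2008, I §3 (1.3.2)] -/
theorem integrates_iff (h : C(G, M)) (c : contTwoCocycles Z) :
    Integrates ι h c ↔ ∀ σ τ : G, ι.hom (c.1 (σ, τ)) = M.ρ σ (h τ) - h (σ * τ) + h σ := Iff.rfl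

omit [IsTopologicalGroup G] [LocallyCompactSpace G] in
/-- Additivity: `h + h'` integrates `c + c'`. [cite: NeukirchSchmidtWingberg2008, I §3 (1.3.2)] -/
theorem Integrates.add {h h' : C(G, M)} {c c' : contTwoCocycles Z} (hh : Integrates ι h c) (hh' : Integrates ι h' c') :
    Integrates ι (h + h') (c + c') := fun σ τ => by
  rw [Submodule.coe_add, ContinuousMap.add_apply, map_add, hh σ τ, hh' σ τ]
  simp only [ContinuousMap.add_apply, map_add]
  abel

omit [IsTopologicalGroup G] [LocallyCompactSpace G] in
/-- Scalars: `r • h` integrates `r • c`. [cite: NeukirchSchmidtWingberg2008, I §3 (1.3.2)] -/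
theorem Integrates.smul {h : C(G, M)} {c : contTwoCocycles Z} (hh : Integrates ι h c) (r : R) :
    Integrates ι (r • h) (r • c) := fun σ τ => by
  rw [Submodule.coe_smul, ContinuousMap.smul_apply, map_smul, hh σ τ]
  simp only [ContinuousMap.smul_apply, map_smul, smul_sub, smul_add]

omit [IsTopologicalGroup G] [LocallyCompactSpace G] in
/-- Negation: `-h` integrates `-c`. [cite: NeukirchSchmidtWingberg2008, I §3 (1.3.2)] -/
theorem Integrates.neg {h : C(G, M)} {c : contTwoCocycles Z} (hh : Integrates ι h c) : Integrates ι (-h) (-c) := fun σ τ => by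
  rw [Submodule.coe_neg, ContinuousMap.neg_apply, map_neg, hh σ τ]
  simp only [ContinuousMap.neg_apply, map_neg]
  abel

omit [IsTopologicalGroup G] [LocallyCompactSpace G] in
/-- Subtraction: `h − h'` integrates `c − c'`. [cite: NeukirchSchmidtWingberg2008, I §3 (1.3.2)] -/
theorem Integrates.sub {h h' : C(G, M)} {c c' : contTwoCocycles Z} (hh : Integrates ι h c) (hh' : Integrates ι h' c') :
    Integrates ι (h - h') (c - c') := by
  rw [sub_eq_add_neg, sub_eq_add_neg]; exact hh.add ι hh'.neg

omit [IsTopologicalGroup G] [LocallyCompactSpace G] in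
/-- **An `M`-cocycle integrates `0`**: if `h` is itself a crossed homomorphism of `M` (`h(στ) = h σ + σ h τ`) then it
integrates the zero `2`-cocycle. [cite: NeukirchSchmidtWingberg2008, I §3 (1.3.2)] -/
theorem integrates_zero_of_cocycle (h : C(G, M)) (hz : ∀ σ τ : G, h (σ * τ) = h σ + M.ρ σ (h τ)) :
    Integrates ι h 0 := fun σ τ => by
  rw [Submodule.coe_zero, ContinuousMap.zero_apply, map_zero, hz σ τ]
  abel

/-- The image `ι ∘ k` of a `Z`-valued continuous cochain. [cite: NeukirchSchmidtWingberg2008, I §3 (1.3.2)] -/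
def mapCochain (k : C(G, Z)) : C(G, M) := ⟨fun τ => ι.hom (k τ), ι.hom.continuous.comp k.continuous⟩

omit [IsTopologicalGroup G] [LocallyCompactSpace G] in
/-- Unfolding `mapCochain`. [cite: NeukirchSchmidtWingberg2008, I §3 (1.3.2)] -/
@[simp] theorem mapCochain_apply (k : C(G, Z)) (τ : G) : mapCochain ι k τ = ι.hom (k τ) := rfl

/-- **A `Z`-valued change of the integrating cochain changes the class by nothing**: if `h` integrates `c` and the
continuous cochain `h − ι∘k` is a crossed homomorphism of `M`, then `[c] = 0` in `H²(G, Z)` (`c = ∂k` by injectivity of `ι`).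
[cite: NeukirchSchmidtWingberg2008, I §3 (1.3.2)] [cite: SerreGaloisCohomology1997, I §2.3] -/
theorem twoCocycleClass_eq_zero_of_integrates (hι : Function.Injective ι.hom) {h : C(G, M)} {c : contTwoCocycles Z}
    (hh : Integrates ι h c) (k : C(G, Z))
    (hz : ∀ σ τ : G, h (σ * τ) - ι.hom (k (σ * τ)) = (h σ - ι.hom (k σ)) + M.ρ σ (h τ - ι.hom (k τ))) :
    twoCocycleClass Z c = 0 := by
  rw [twoCocycleClass_eq_zero_iff]
  refine ⟨k, fun σ τ => hι ?_⟩
  rw [hh σ τ, map_add, map_sub, TopRep.hom_comm_apply ι σ (k τ)]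
  have e := hz σ τ
  rw [map_sub] at e
  have e' : h (σ * τ) = (h σ - ι.hom (k σ)) + (M.ρ σ (h τ) - M.ρ σ (ι.hom (k τ))) + ι.hom (k (σ * τ)) := by
    rw [← e]; abel
  rw [e']; abel

/-- **Well-definedness of the connecting class `δ[h mod Z] := [c]`.** If `h` integrates `c`, `h'` integrates `c'`, and
`h − h' − ι∘k` is a crossed homomorphism of `M` for some `Z`-valued continuous cochain `k` (i.e. `h ≡ h'` modulo
`ι(C¹(G, Z)) + Z¹(G, M)`), then `[c] = [c']` in `H²(G, Z)`, for injective `ι`.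
[cite: NeukirchSchmidtWingberg2008, I §3 (1.3.2)] [cite: SerreGaloisCohomology1997, I §2.2] -/
theorem twoCocycleClass_eq_of_integrates (hι : Function.Injective ι.hom) {h h' : C(G, M)} {c c' : contTwoCocycles Z}
    (hh : Integrates ι h c) (hh' : Integrates ι h' c') (k : C(G, Z))
    (hz : ∀ σ τ : G, (h (σ * τ) - h' (σ * τ)) - ι.hom (k (σ * τ)) =
      ((h σ - h' σ) - ι.hom (k σ)) + M.ρ σ ((h τ - h' τ) - ι.hom (k τ))) :
    twoCocycleClass Z c = twoCocycleClass Z c' := by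
  rw [← sub_eq_zero, ← twoCocycleClass_sub]
  exact twoCocycleClass_eq_zero_of_integrates ι hι (hh.sub ι hh') k (fun σ τ => by
    simpa only [ContinuousMap.sub_apply] using hz σ τ)

end Integrates

/-! ## §2 Kato's formal argument: `f ∪ g = ∂(τ ↦ Φ(x, g τ))` when `f = ∂x` in a bigger module -/

section Cup

variable {X Y Z MX MZ : TopRep.{v} R G} (φ : ContPairing X Y Z) (Φ : ContPairing MX Y MZ)
  (iX : X ⟶ MX) (ι : Z ⟶ MZ)

/-- The explicit integrating cochain `τ ↦ Φ(x, g τ)` of Kato's Lemma II.1.4.3. [cite: Kato1993LNM1553, Ch. II Lemma 1.4.3] -/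
def cupIntegratingCochain (x : MX) (g : contOneCocycles Y) : C(G, MZ) :=
  ⟨fun τ => Φ.toLin x (g.1 τ), Φ.continuous_toLin.comp (continuous_const.prodMk g.1.continuous)⟩

omit [IsTopologicalGroup G] [LocallyCompactSpace G] in
/-- Unfolding `cupIntegratingCochain`. [cite: Kato1993LNM1553, Ch. II Lemma 1.4.3] -/
@[simp] theorem cupIntegratingCochain_apply (x : MX) (g : contOneCocycles Y) (τ : G) :
    cupIntegratingCochain Φ x g τ = Φ.toLin x (g.1 τ) := rfl

omit [LocallyCompactSpace G] in
/-- ★ **Kato II Lemma 1.4.3, formal part.** Let `φ : X × Y → Z` and `Φ : M_X × Y → M_Z` be continuous equivariant pairings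
compatible along `i_X : X → M_X`, `ι : Z → M_Z` (`Φ(i_X x, y) = ι φ(x, y)`). If the `1`-cocycle `f` of `X` becomes a
coboundary in `M_X`, `i_X(f σ) = σ x − x`, then for every `1`-cocycle `g` of `Y` the cup product `f ∪ g`
(`(σ, τ) ↦ ⟨f σ, σ g τ⟩`, tree `ContPairing.cupCocycle`) is integrated along `ι` by `h(τ) = Φ(x, g τ)`:
`ι((f ∪ g)(σ,τ)) = σ h(τ) − h(στ) + h(σ)`, i.e. `[f ∪ g] = δ[h mod Z]`. [cite: Kato1993LNM1553, Ch. II Lemma 1.4.3]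
[cite: NeukirchSchmidtWingberg2008, I §4 (1.4.3)] -/
theorem integrates_cupCocycle_of_eq_sub (hcompat : ∀ (x : X) (y : Y), Φ.toLin (iX.hom x) y = ι.hom (φ.toLin x y))
    (f : contOneCocycles X) (x : MX) (hx : ∀ σ : G, iX.hom (f.1 σ) = MX.ρ σ x - x) (g : contOneCocycles Y) :
    Integrates ι (cupIntegratingCochain Φ x g) (φ.cupCocycle f g) := fun σ τ => by
  have hg : g.1 (σ * τ) = g.1 σ + Y.ρ σ (g.1 τ) := g.2 σ τ
  rw [ContPairing.cupCocycle_apply, ← hcompat, hx σ, cupIntegratingCochain_apply, cupIntegratingCochain_apply,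
    cupIntegratingCochain_apply, hg, add_sub_cancel_left, map_sub, LinearMap.sub_apply, Φ.toLin_smul, map_add]
  abel

end Cup

/-! ## §3 Calibration cochains `τ ↦ ψ(τ) • ℓ` -/

section Scalar

variable {Z M : TopRep.{v} R G} (ι : Z ⟶ M)

/-- **The cup product `(σ, τ) ↦ ψ(τ) • κ(σ)` of a `1`-cocycle `κ` of `Z` with a continuous additive character
`ψ : G → R`** (the pairing `Z × R_triv → Z`, `(z, r) ↦ r•z`), as a continuous `2`-cocycle of `Z`.
[cite: NeukirchSchmidtWingberg2008, I §4 (1.4.1)] -/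
def smulCupCocycle (κ : contOneCocycles Z) (ψ : G → R) (hψ : ∀ σ τ, ψ (σ * τ) = ψ σ + ψ τ) (hψc : Continuous ψ) :
    contTwoCocycles Z :=
  ⟨⟨fun q => ψ q.2 • κ.1 q.1, (hψc.comp continuous_snd).smul (κ.1.continuous.comp continuous_fst)⟩, fun σ τ υ => by
    change Z.ρ σ (ψ υ • κ.1 τ) + ψ (τ * υ) • κ.1 σ = ψ υ • κ.1 (σ * τ) + ψ τ • κ.1 σ
    rw [κ.2 σ τ, hψ, map_smul, smul_add, add_smul]
    abel⟩

omit [IsTopologicalGroup G] [LocallyCompactSpace G] in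
/-- Unfolding `smulCupCocycle`. [cite: NeukirchSchmidtWingberg2008, I §4 (1.4.1)] -/
@[simp] theorem smulCupCocycle_apply (κ : contOneCocycles Z) (ψ : G → R) (hψ : ∀ σ τ, ψ (σ * τ) = ψ σ + ψ τ)
    (hψc : Continuous ψ) (σ τ : G) : (smulCupCocycle κ ψ hψ hψc).1 (σ, τ) = ψ τ • κ.1 σ := rfl

/-- The calibration cochain `τ ↦ ψ(τ) • ℓ`. [cite: Kato1993LNM1553, Ch. II §1.4.4] -/
def smulCochain (ℓ : M) (ψ : G → R) (hψc : Continuous ψ) : C(G, M) := ⟨fun τ => ψ τ • ℓ, hψc.smul continuous_const⟩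

omit [IsTopologicalGroup G] [LocallyCompactSpace G] in
/-- Unfolding `smulCochain`. [cite: Kato1993LNM1553, Ch. II §1.4.4] -/
@[simp] theorem smulCochain_apply (ℓ : M) (ψ : G → R) (hψc : Continuous ψ) (τ : G) : smulCochain ℓ ψ hψc τ = ψ τ • ℓ := rfl

omit [IsTopologicalGroup G] [LocallyCompactSpace G] in
/-- ★ **Kato II §1.4.4 in cochain form.** If `ℓ ∈ M` integrates the `1`-cocycle `κ` of `Z` (`ι(κ σ) = σ ℓ − ℓ`: e.g.
`ℓ = ℓ_u = log([ũ]u⁻¹) ∈ B_dR⁺`, `κ` the Kummer cocycle of `u` times `t`, tree `BdRKummerUnitPeriod.gal_kummerUnitLog_eq`) and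
`ψ : G → R` is a continuous additive character, then `τ ↦ ψ(τ)•ℓ` integrates the cup product `(σ,τ) ↦ ψ(τ)•κ(σ)`:
`[κ ∪ ψ] = δ[ψ•ℓ mod Z]` (`δ(a·log χ) = exp(a) ∪ log χ`). [cite: Kato1993LNM1553, Ch. II §1.4.4]
[cite: NeukirchSchmidtWingberg2008, I §3 (1.3.2)] -/
theorem integrates_smulCochain_of_sub_eq (ℓ : M) (κ : contOneCocycles Z) (hℓ : ∀ σ : G, ι.hom (κ.1 σ) = M.ρ σ ℓ - ℓ)
    (ψ : G → R) (hψ : ∀ σ τ, ψ (σ * τ) = ψ σ + ψ τ) (hψc : Continuous ψ) :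
    Integrates ι (smulCochain ℓ ψ hψc) (smulCupCocycle κ ψ hψ hψc) := fun σ τ => by
  rw [smulCupCocycle_apply, map_smul, hℓ, smulCochain_apply, smulCochain_apply, smulCochain_apply, hψ, map_smul, smul_sub,
    add_smul]
  abel

end Scalar

end Literature.NumberTheory.GaloisRepresentations

end
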